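import Literature.Computability.Complexity.ThetaApproximation
import Literature.Computability.Complexity.ThetaFWMachineMain
import HarnessLib

/-!
# Discharge of `GLS1981_thetaApprox_unary_FP` (Grötschel–Lovász–Schrijver 1981, §6): `ϑ` is approximable in polynomial time

Proof file for `ThetaApproximation.lean`. The named fact `GLS1981_thetaApprox_unary_FP` — there is an
`FP` string function which, on `⟨code of the graph H on n vertices, 1ᵐ⟩` (`m ≥ 1`), outputs the binary
numeral of a natural number `z` with `m ϑ(H) ≤ z ≤ m ϑ(H) + 2` — is PROVED here
(`GLS1981_thetaApprox_unary_FP_holds`), by the machine `ThetaFWMachine.thetaMachineF`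
(`ThetaFWMachineTables.lean`, `ThetaFWMachineStep.lean`, `ThetaFWMachineMain.lean`): a polynomial-time
implementation, in the tree's brick algebra of `FP` string functions, of the saturated integer
Frank–Wolfe algorithm `ThetaFW.thetaZCap` (Hazan's spectraplex Frank–Wolfe method, Jaggi 2011 Alg. 6,
with a power-method oracle, on the penalised objective of `LovaszThetaPenalty.lean`; defined in
`LovaszThetaFWAlgorithm.lean`, analysed in `LovaszThetaFWCorrect.lean` — `mϑ ≤ thetaZ ≤ mϑ + 2` — and
shown insensitive to saturation at polynomial width in `LovaszThetaFWCap.lean`, `thetaZCap_toNat_spec`).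
What this file adds: the budget estimate (`budget_bounds`: the width `W = 2³¹(|inp| + 1)³⁹` of the
machine's yardstick dominates `n`, the power exponent `r`, the iteration count `T`, the precision `p`
and the saturation threshold `cW` of `LovaszThetaFWCap.lean`, all polynomial in `n, m ≤ |inp|`), the
degenerate case `n = 0` (`thetaZCap = 0`, `ϑ ≥ 0`), and the assembly.

The printed GLS algorithm is the ellipsoid method with the accuracy in binary; the fact vendored in the
tree is the (weaker) unary-accuracy form, which any `poly(n, 1/ε)` first-order scheme discharges — see
the module docstring of `ThetaApproximation.lean` for the discussion and for why this is exactly the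
form Tardos 1988 consumes.

## References

* M. Grötschel, L. Lovász, A. Schrijver, *The ellipsoid method and its consequences in combinatorial
  optimization*, Combinatorica 1 (1981) 169–197, §6 (pp. 192–194) and Thm. (3.1)
  [GrotschelLovaszSchrijver1981] (held: `lit read doi:10.1007/bf02579273`, PDF pp. 24–26).
* M. Jaggi, *Convex optimization without projection steps*, arXiv:1108.1170 (2011), Alg. 6, Thm. 17–18
  [Jaggi2011].
* É. Tardos, Combinatorica 8 (1988) 141–142, p. 142 [Tardos1988].
* S. Arora, B. Barak, *Computational Complexity: A Modern Approach*, CUP 2009, §1.3 [AroraBarak2009].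
-/

noncomputable section

namespace Literature.Computability.Complexity

open _root_.Computability Polynomial Brick Literature.Combinatorics.SimpleGraph
  Literature.Combinatorics.SimpleGraph.ThetaFW ThetaFWMachine Matrix Finset

namespace ThetaFWMachine

/-! ### The budget: the width dominates the constants -/

/-- **The constants of `ThetaFW` against a common bound `B ≥ n, m`, `B ≥ 1`**:
`r ≤ 2¹⁴ B¹⁹`, `T ≤ 2⁹ B⁸`, `p ≤ (2¹⁵ + 1) B²⁰`, `cW ≤ 2³¹ B³⁹`. [folklore] -/
theorem budget_bounds {n m B : ℕ} (hn : n ≤ B) (hm : m ≤ B) (hB : 1 ≤ B) :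
    cr n m ≤ 2 ^ 14 * B ^ 19 ∧ cT n m ≤ 2 ^ 9 * B ^ 8 ∧ cp n m ≤ (2 ^ 15 + 1) * B ^ 20 ∧ cW n m ≤ 2 ^ 31 * B ^ 39 := by
  have hB7 : 1 ≤ B ^ 7 := Nat.one_le_pow _ _ hB
  have hB20 : 1 ≤ B ^ 20 := Nat.one_le_pow _ _ hB
  have hn6 : n ^ 6 ≤ B ^ 6 := Nat.pow_le_pow_left hn 6
  have hn16 : n ^ 16 ≤ B ^ 16 := Nat.pow_le_pow_left hn 16
  have hm2 : m ^ 2 ≤ B ^ 2 := Nat.pow_le_pow_left hm 2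
  have hm4 : m ^ 4 ≤ B ^ 4 := Nat.pow_le_pow_left hm 4
  -- `M ≤ B⁷`
  have hM : cM n m ≤ B ^ 7 := by
    calc cM n m = n ^ 6 * m := rfl
      _ ≤ B ^ 6 * B := Nat.mul_le_mul hn6 hm
      _ = B ^ 7 := by ring
  -- `c₀ ≤ 3 B⁸`
  have hc0 : c0 n m ≤ 3 * B ^ 8 := by
    calc c0 n m = n * (1 + 2 * cM n m) := rfl
      _ ≤ B * (B ^ 7 + 2 * B ^ 7) := Nat.mul_le_mul hn (by omega)
      _ = 3 * B ^ 8 := by ring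
  -- `q ≤ 96 B⁹`
  have hq : cq n m ≤ 96 * B ^ 9 := by
    calc cq n m = 32 * m * c0 n m := rfl
      _ ≤ 32 * B * (3 * B ^ 8) := Nat.mul_le_mul (Nat.mul_le_mul_left _ hm) hc0
      _ = 96 * B ^ 9 := by ring
  -- `k ≤ 97 B¹⁰`
  have hk : ck n m ≤ 97 * B ^ 10 := by
    have h1 : Nat.log 2 (n * cq n m) ≤ n * cq n m := Nat.log_le_self _ _
    have h2 : n * cq n m ≤ B * (96 * B ^ 9) := Nat.mul_le_mul hn hq
    have h3 : 1 ≤ B ^ 10 := Nat.one_le_pow _ _ hB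
    calc ck n m = Nat.log 2 (n * cq n m) + 1 := rfl
      _ ≤ B * (96 * B ^ 9) + B ^ 10 := by omega
      _ = 97 * B ^ 10 := by ring
  -- `r ≤ 2¹⁴ B¹⁹`
  have hr : cr n m ≤ 2 ^ 14 * B ^ 19 := by
    calc cr n m = cq n m * ck n m := rfl
      _ ≤ (96 * B ^ 9) * (97 * B ^ 10) := Nat.mul_le_mul hq hk
      _ = 9312 * B ^ 19 := by ring
      _ ≤ 2 ^ 14 * B ^ 19 := Nat.mul_le_mul_right _ (by norm_num)
  -- `T ≤ 2⁹ B⁸`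
  have hT : cT n m ≤ 2 ^ 9 * B ^ 8 := by
    calc cT n m = 512 * n ^ 6 * m ^ 2 := rfl
      _ ≤ 512 * B ^ 6 * B ^ 2 := Nat.mul_le_mul (Nat.mul_le_mul_left _ hn6) hm2
      _ = 2 ^ 9 * B ^ 8 := by ring
  -- `p ≤ (2¹⁵ + 1) B²⁰`
  have hp : cp n m ≤ (2 ^ 15 + 1) * B ^ 20 := by
    have h1 : Nat.log 2 (2 ^ 15 * n ^ 16 * m ^ 4) ≤ 2 ^ 15 * n ^ 16 * m ^ 4 := Nat.log_le_self _ _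
    have h2 : 2 ^ 15 * n ^ 16 * m ^ 4 ≤ 2 ^ 15 * B ^ 16 * B ^ 4 := Nat.mul_le_mul (Nat.mul_le_mul_left _ hn16) hm4
    calc cp n m = Nat.log 2 (2 ^ 15 * n ^ 16 * m ^ 4) + 1 := rfl
      _ ≤ 2 ^ 15 * B ^ 16 * B ^ 4 + B ^ 20 := by omega
      _ = (2 ^ 15 + 1) * B ^ 20 := by ring
  refine ⟨hr, hT, hp, ?_⟩
  -- `cW = r (n + (p + 7n + m + 6)) + 1 ≤ 2¹⁴ B¹⁹ · 2¹⁶ B²⁰ + 1 ≤ 2³¹ B³⁹`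
  have hin : n + (cp n m + 7 * n + m + 6) ≤ 2 ^ 16 * B ^ 20 := by
    have h1 : B ≤ B ^ 20 := by
      calc B = B ^ 1 := (pow_one B).symm
        _ ≤ B ^ 20 := Nat.pow_le_pow_right hB (by norm_num)
    calc n + (cp n m + 7 * n + m + 6) ≤ B + ((2 ^ 15 + 1) * B ^ 20 + 7 * B + B + 6) := by omega
      _ ≤ B ^ 20 + ((2 ^ 15 + 1) * B ^ 20 + 7 * B ^ 20 + B ^ 20 + 6 * B ^ 20) := by omega
      _ = (2 ^ 15 + 16) * B ^ 20 := by ring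
      _ ≤ 2 ^ 16 * B ^ 20 := Nat.mul_le_mul_right _ (by norm_num)
  have h39 : 1 ≤ B ^ 39 := Nat.one_le_pow _ _ hB
  calc cW n m = cr n m * (n + (cp n m + 7 * n + m + 6)) + 1 := rfl
    _ ≤ (2 ^ 14 * B ^ 19) * (2 ^ 16 * B ^ 20) + B ^ 39 := Nat.add_le_add (Nat.mul_le_mul hr hin) h39
    _ = (2 ^ 30 + 1) * B ^ 39 := by ring
    _ ≤ 2 ^ 31 * B ^ 39 := Nat.mul_le_mul_right _ (by norm_num)

/-- The input is at least as long as `n` and `m`. [folklore] -/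
theorem le_length_inputCode (m : ℕ) {n : ℕ} (H : SimpleGraph (Fin n)) :
    n ≤ (inputCode m H).length ∧ m ≤ (inputCode m H).length := by
  have hl : (inputCode m H).length = 2 * (2 * (encodeNat n).length + 2 + n * n) + 2 + m := by
    have hu : (unaryEncodeNat m).length = m := unary_decode_encode_nat m
    rw [inputCode, length_boolPair, length_boolPair, CliqueNP.length_adjBits, hu]
  have hnn : n ≤ n * n := by
    rcases Nat.eq_zero_or_pos n with rfl | hpos
    · simp
    · exact Nat.le_mul_of_pos_left n hpos
  omega

/-- **The side conditions of the run hold on every genuine input** (under classical decidability of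
adjacency, which is how the graph code is written). [folklore] -/
theorem runHyp (m : ℕ) {n : ℕ} (H : SimpleGraph (Fin n)) :
    @RunHyp n m H (fun a b => Classical.propDecidable (H.Adj a b)) := by
  letI : DecidableRel H.Adj := fun a b => Classical.propDecidable (H.Adj a b)
  obtain ⟨hnL, hmL⟩ := le_length_inputCode m H
  set B := (inputCode m H).length + 1 with hBdef
  have hB : 1 ≤ B := by omega
  obtain ⟨hr, hT, hp, _⟩ := budget_bounds (B := B) (n := n) (m := m) (by omega) (by omega) hB
  have hW : width (inputCode m H) = 2 ^ 31 * B ^ 39 := by rw [width, budgetPoly_eval]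
  have h19 : B ^ 19 ≤ B ^ 39 := Nat.pow_le_pow_right hB (by norm_num)
  have h8 : B ^ 8 ≤ B ^ 39 := Nat.pow_le_pow_right hB (by norm_num)
  have h20 : B ^ 20 ≤ B ^ 39 := Nat.pow_le_pow_right hB (by norm_num)
  have h1 : B ≤ B ^ 39 := by
    calc B = B ^ 1 := (pow_one B).symm
      _ ≤ B ^ 39 := Nat.pow_le_pow_right hB (by norm_num)
  refine ⟨?_, ?_, ?_, ?_, ?_⟩
  · rw [hW]
    calc n ≤ B := by omega
      _ ≤ B ^ 39 := h1
      _ ≤ 2 ^ 31 * B ^ 39 := Nat.le_mul_of_pos_left _ (by norm_num)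
  · rw [hW]
    calc cr n m ≤ 2 ^ 14 * B ^ 19 := hr
      _ ≤ 2 ^ 31 * B ^ 39 := Nat.mul_le_mul (by norm_num) h19
  · rw [hW]
    calc cT n m ≤ 2 ^ 9 * B ^ 8 := hT
      _ ≤ 2 ^ 31 * B ^ 39 := Nat.mul_le_mul (by norm_num) h8
  · rw [hW]
    calc cp n m ≤ (2 ^ 15 + 1) * B ^ 20 := hp
      _ ≤ 2 ^ 31 * B ^ 39 := Nat.mul_le_mul (by norm_num) h20
  · intro i j
    exact CliqueNP.getD_adjBits_flat H i j

/-- The width of a genuine input is at least the saturation threshold `cW`. [folklore] -/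
theorem cW_le_width (m : ℕ) {n : ℕ} (H : SimpleGraph (Fin n)) : cW n m ≤ width (inputCode m H) := by
  obtain ⟨hnL, hmL⟩ := le_length_inputCode m H
  obtain ⟨-, -, -, hW⟩ := budget_bounds (B := (inputCode m H).length + 1) (n := n) (m := m) (by omega) (by omega) (by omega)
  rw [width, budgetPoly_eval]
  exact hW

/-! ### The degenerate case `n = 0` -/

/-- On the empty graph the saturated output is `0` (all sums are empty and `⌈0/0⌉ = 0`). [folklore] -/
theorem thetaZCap_zero (m W : ℕ) (H : SimpleGraph (Fin 0)) [DecidableRel H.Adj] : thetaZCap 0 m H W = 0 := by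
  simp [thetaZCap, outNum, ceilDiv, Matrix.trace, eSumInt, qSumInt]

end ThetaFWMachine

/-! ### The discharge -/

open Literature.Combinatorics.SimpleGraph Literature.Combinatorics.SimpleGraph.ThetaFW

/-- **Grötschel–Lovász–Schrijver 1981, §6 (accuracy in unary): the Lovász number is approximable in
polynomial time — PROVED.** The `FP` string function `ThetaFWMachine.thetaMachineF` maps
`⟨code of H, 1ᵐ⟩` (`m ≥ 1`) to the binary numeral of `z = (ThetaFW.thetaZCap n m H W).toNat`, and
`m ϑ(H) ≤ z ≤ m ϑ(H) + 2` by `ThetaFW.thetaZCap_toNat_spec` (`n ≥ 1`, the width `W` of the run being at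
least the saturation threshold `cW`, `cW_le_width`); for `n = 0`, `z = 0` and `ϑ = 0 ≥ 0`.
[cite: GrotschelLovaszSchrijver1981, §6 (pp. 192–194) and Thm. (3.1)] [cite: Jaggi2011, Alg. 6, Thm. 17] [cite: Tardos1988, p. 142] -/
theorem GLS1981_thetaApprox_unary_FP_holds : GLS1981_thetaApprox_unary_FP := by
  refine ⟨ThetaFWMachine.thetaMachineF, ThetaFWMachine.thetaMachineF_mem_FP, fun n H m hm => ?_⟩
  letI : DecidableRel H.Adj := fun a b => Classical.propDecidable (H.Adj a b)
  have hrun := ThetaFWMachine.runHyp m H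
  have hout := ThetaFWMachine.thetaMachineF_input hrun
  rw [ThetaFWMachine.inputCode_eq] at hout
  refine ⟨(thetaZCap n m H (ThetaFWMachine.width (ThetaFWMachine.inputCode m H))).toNat, hout, ?_⟩
  rcases Nat.eq_zero_or_pos n with rfl | hn
  · -- the empty graph: `z = 0` and `ϑ = 0` (`0 ≤ ϑ ≤ |V| = 0`)
    rw [ThetaFWMachine.thetaZCap_zero]
    have h0 : 0 ≤ lovaszTheta H := lovaszTheta_nonneg H
    have h1 : lovaszTheta H ≤ 0 := by simpa using lovaszTheta_le_card H
    have hm0 : (0 : ℝ) ≤ m := Nat.cast_nonneg m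
    simp only [Int.toNat_zero, Nat.cast_zero]
    constructor <;> nlinarith
  · exact (thetaZCap_toNat_spec (H := H) hn hm (ThetaFWMachine.cW_le_width m H)).2

end Literature.Computability.Complexity

end
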